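import Mathlib
import HarnessLib
import Literature.Analysis.FluidPDE.VorticityCalculus
import Summits.NavierStokesRegularity.NavierStokesRegularity.Theses.LoopPeriodRatchet
import Summits.NavierStokesRegularity.NavierStokesRegularity.Theorems.LiouvilleConjectureNS
import Summits.NavierStokesRegularity.NavierStokesRegularity.Theorems.LoopPeriodRatchetNoLoopsOfGrowth
import Summits.NavierStokesRegularity.NavierStokesRegularity.Theorems.LoopPeriodRatchetNoPlanarExtremum
import Summits.NavierStokesRegularity.NavierStokesRegularity.Theorems.LoopPeriodRatchetNoLoopsOfRatchet
import Summits.NavierStokesRegularity.NavierStokesRegularity.Theorems.LoopPeriodRatchetPeriodScalingBound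
import Summits.NavierStokesRegularity.NavierStokesRegularity.Theorems.PoloidalWindowDoorPoloidalWindowRigidityWindow
import Summits.NavierStokesRegularity.NavierStokesRegularity.Theorems.SqueezeCycleExtremalBiaxialitySubcriticalOfLiouville
import Summits.NavierStokesRegularity.NavierStokesRegularity.Theorems.PoloidalWindowDoorPoloidalWindowRigidityHotLoopsPeakless
import Summits.NavierStokesRegularity.NavierStokesRegularity.Theorems.FrequencyGrowthExponent.Negative.LoadBearing
import Summits.NavierStokesRegularity.NavierStokesRegularity.Theorems.FrequencyGrowthExponent.Negative.Reductions
import Summits.NavierStokesRegularity.NavierStokesRegularity.Theorems.FrequencyGrowthExponent.Negative.Strata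
import Summits.NavierStokesRegularity.NavierStokesRegularity.Theorems.FrequencyGrowthExponent.Negative.Amplitude
import Summits.NavierStokesRegularity.NavierStokesRegularity.Theorems.FrequencyGrowthExponent.Negative.Rigidity
import Summits.NavierStokesRegularity.NavierStokesRegularity.Theorems.FrequencyGrowthExponent.Negative.Recurrence
import Summits.NavierStokesRegularity.NavierStokesRegularity.Theorems.FrequencyGrowthExponent.Negative.Island

/-!
# Disproof of `FrequencyGrowthExponent` (stmt-NavierStokesRegularity-27893) — findings

Standing disprover's work file (cdisprove, req192 negation-first; units `cdisprove-stmt-NavierStokesRegularity-27893-g0`, `…-g1`).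
Crux (rank 2 of `LoopPeriodRatchet`, the shared wall S6G / ⟨27893⟩ behind hot_loops, far_thread S3 and the 22881-reduction):
every e₃-poloidal Type-I Oseen-mild ancient profile propagates closed vortex lines backward with a period growth exponent
`κ < 3/2`.  Prose lives only in docstrings; everything below is kernel-checked (no `sorry` in this version); the substance is
LANDED under `Theorems/FrequencyGrowthExponent/Negative/{LoadBearing,Reductions,Strata,Amplitude,Rigidity,Recurrence,Island}.lean`
and importable from there (v3, g1: F5 census v2, F6 amplitude/energy thresholds, F7 rigidity / recurrence strata, F8 island door).

## Findings (index)

* **F1 — refutation criterion** (§A; LANDED p671423 `Negative/Reductions.lean`, re-exported):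
  `criterion : ¬ FrequencyGrowthExponent ↔ HasClassLoop` — given the PROVED floor
  `PeriodScalingBound` and engine `NoLoopsOfGrowth`, the exponent `κ`, the constant `A` and the ratio clause are INERT:
  the wall is exactly «no profile of the class carries a non-stationary closed vortex line» (`W := HasClassLoop` is the
  construction target).  Also `FrequencyGrowthExponent ↔ PeriodRatchet` (the two open walls of the route coincide) and
  the hot_loops form `HasClassPlanarPeak → ¬ FrequencyGrowthExponent` (strict planar extremum of `±v₃`, via the landed
  `…HotLoopsPeakless.zero_of_strictPlanarExtremum`).
* **F2 — the adversary's bar** (§A): `HasClassLoop → ¬ LiouvilleConjectureNS`: a witness is (after a time shift) a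
  non-constant bounded ancient mild solution, i.e. a counterexample to KNSS (L) = a Type-I blow-up profile
  (Albritton–Barker 2019, Thm 1.1).  Hence `W` is NOT constructible with present knowledge; the landing is the
  negative lemma «¬FGE modulo W» (LANDED p671423), the item stays OPEN.
* **F3 — load-bearing binders** (§B; LANDED p671142 `Negative/LoadBearing.lean`): WITHOUT the Oseen–Duhamel binder the
  wall is FALSE (Gaussian column `ramp(t)·e^{-(x₀²+x₁²)} e₂`: the unit circle is a vortex loop of angular frequency
  `2/e` at `t = -1`, the slice `t₀ = -2` is zero — vorticity born from nothing); WITHOUT the non-stationarity clause of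
  the hypothesis loop it is FALSE (zero profile).  Any proof must use the NS coupling between slices.
* **F4 — settled strata carry no loop** (§C; LANDED p671431 `Negative/Strata.lean`): on the translation-invariant
  (any direction), locally-aligned (one slice, one open set), flat-poloidal (`∂₀v₂ ≡ 0`) and axisymmetric-poloidal
  strata the slice vorticity vanishes identically, so `W` lies off all of them (`no_loop_of_*` below).
* **F5 — W-census v2 (paper + tree; PREREG.md / PREREG-v2.md attached to the item; no kit run).**  `W` needs a NON-TRIVIAL
  e₃-poloidal profile of the KNSS-gauge Type-I class (`Negative.HasClassLoop → ¬LiouvilleConjectureNS`, F2), so each ansatz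
  is judged by whether a nonzero class member of that shape can exist.  Words (crit-7 PREREG vocabulary):
  - A1 backward self-similar — NOT-FOUND BY THEOREM (tree: `…SymmetryExclusions.eq_zero_of_selfSimilar`, Tsai 1998 Thm 1 in
    the Oseen gauge; F7 `no_loop_of_selfSimilar`);
  - A1′ backward ROTATED self-similar (Perelman–type RSS, `v(t,x) = (−t)^{-1/2} R_{α log(−t)} U(R_{−α log(−t)} x/√(−t))`,
    rotation about e₃ — the only axis compatible with `ω₃ ≡ 0`) — INCONCLUSIVE: Pineau–Vicol 2026 (arXiv:2607.09619) Thm 1.4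
    excludes `|α| ≪ 1` and `|α| ≫ 1` under their bound (1.10), Conj. 1.1 (no bounded RSS profile, all α) is OPEN; the
    helical / screw-periodic sub-case is NOT-FOUND BY THEOREM (F7 `no_loop_of_helical`);
  - A2 backward λ-DSS — INCONCLUSIVE by nature (= Type-I blow-up existence, Bradshaw–Tsai Q5.1); `λ → 1` and small
    constant excluded (Chae–Wolf 2017; tree `Literature/Barriers/…/NearOneDssTypeIExclusion`); every DSS witness still
    has Type-I constant `≥ 1` (F7) and unbounded energy (F6);
  - A3 unidirectional / caloric columns, A4 x₃-modulated cellular banks, A5 translation-invariant / aligned / flat /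
    axisymmetric — NOT-FOUND BY THEOREM (F3, F4; A4 is not mild);
  - A6 spatially periodic in ANY one direction (lattices, arrays, x₃-periodic banks of rings) — NOT-FOUND BY THEOREM
    (F7 `no_loop_of_periodic`, tree `PeriodicGauge.periodic_typeI_liouville_genuine`);
  - A7 steady / time-periodic / locally time-recurrent — NOT-FOUND BY THEOREM (tree `eq_zero_of_germ_timeRecurrent`;
    F7 `Negative.no_loop_of_germ_timeRecurrent`, `no_loop_of_steady`, LANDED p678688 `Negative/Recurrence.lean`);
  - A8 compact-core rings with potential exterior, or any slice with an open irrotational / zero set — NOT-FOUND BY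
    THEOREM (F7 `no_loop_of_openSet_curl_eq_zero`, `no_loop_of_openSet_eq_zero`: slices are real-analytic);
  - A9 small data: Type-I constant `C < 1`, or `≤ ε` on a backward end, or `sup_t ‖v(t)‖_{Lᵖ} < ∞` for some
    `1 ≤ p < 3` (finite energy included) — NOT-FOUND BY THEOREM (F6, F7).
  Census word v2: NOT-FOUND(A1, A3–A9) ∧ INCONCLUSIVE(A1′ α ≈ 1, A2) — the live residue is exactly «a non-trivial bounded
  backward (R)SS/DSS e₃-poloidal profile», i.e. Type-I blow-up existence restricted to the poloidal class; no kit job fits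
  the 20 core-h envelope (a backward profile solver is research-scale), none requested.
* **F6 — amplitude / energy thresholds** (§F; LANDED p675060 `Negative/Amplitude.lean`): a universal `ε > 0` below which
  the class is `{0}` on every backward end (`exists_amplitude_threshold`; KNSS bilinear bound + forward uniqueness), hence
  every witness has Type-I constant `> ε`, is never small in the far past, and has `sup_{t<0} ‖v(t)‖_{Lᵖ} = ∞` for EVERY
  `1 ≤ p < 3` (`hasClassLoop_iff_large`: `W` may assume and must deliver unbounded energy).
* **F7 — rigidity strata** (§G; LANDED p676158 `Negative/Rigidity.lean`): in-tree Liouville theorems over `IsTypeIAncientMild`,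
  pulled back to the class binders — Type-I constant `C < 1` ⇒ `v ≡ 0` (so every witness has `C ≥ 1`,
  `one_le_typeI_constant_of_isVortexLoop`); backward self-similar, spatially periodic (one period), helical (pitch ≠ 0,
  moving vertical axes), one-slice-axisymmetric-about-any-axis (poloidal), open-set-irrotational and open-set-zero slices
  all force `v ≡ 0`: `no_loop_of_{selfSimilar,periodic,helical,axisymmetric_slice_anyAxis,openSet_curl_eq_zero,openSet_eq_zero}`;
  and (LANDED p678688 `Negative/Recurrence.lean`, germ rigidity) time-recurrent germs `v(t₀−δ,·) = v(t₀,·)` on an open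
  set force `v ≡ 0` (`no_loop_of_germ_timeRecurrent`, `no_loop_of_steady`), while two class profiles agreeing on an open
  set at one time carry the same loops (`isVortexLoop_iff_of_germ_eq`).
* **F8 — the island door is the loop door** (§H; LANDED p677901 `Negative/Island.lean`, over K2-p2 g12's sorry-free scalar
  wall `…LoopIslandReduction.frequencyGrowthExponent_iff_noIslands`, p676353): `HasClassLoop ↔ ∃` class e₃-poloidal
  profile with a planar ISLAND BRACKET of `σ v₂` (`σ = ±1`; compact `K ≠ ∅` in a plane `{y₂ = z₁}` where `σ v₂ = M`, an
  open `O ⊇ K` on whose trace `σ v₂ ≤ M` with equality only on `K`) at some `s₀ < 0` — with NO separate non-triviality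
  clause (`slice_ne_zero_of_island`: a bracket on a zero slice would put a whole horizontal line inside the compact `K`).
  A candidate `W` is therefore certified by a planar strict extremal plateau of `±v₂` on ONE slice; `W' = HasClassPlanarPeak`
  (strict planar extremum at a point) is the special case `K = {y₀}`.
* **F9 — line structure under the wall** (§I): `FrequencyGrowthExponent → (OpenLoopLiouville ↔ FrobeniusLiouville)` and
  `FrequencyGrowthExponent → (PlanarExtremumLiouville ↔ FrobeniusLiouville)`, where `FrobeniusLiouville` is 22493 with its
  loop-free hypothesis dropped (= 22881 with its no-planar-extremum hypothesis dropped): once ⟨27893⟩ holds, every class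
  poloidal profile is loop-free (`criterion`) and, by the proved 22880, planar-extremum-free — so in the conjunction
  `closes` consumes, the topological / maximum-principle hypotheses of the residual cruxes carry NO information beyond the
  wall; the line's true residual is the hypothesis-free Frobenius-class poloidal Liouville statement.  (Planner
  information, not a verdict: a nonflat Frobenius-class profile that IS backward-singular would sink the line even with
  ⟨27893⟩ in hand.)

## Targets
None served this cycle (no line picked; payload carries no `targets` / `line`).  The stubs of the skeleton of record
(sha16 9409bfc856b4cbd0: `stub_dyadicStepRatio`, `stub_shortStepPersistence`, `stub_noExtremalLoop`,
`stub_extremalLoopExtraction`) all quantify over the same class; by F1 each is either vacuous-true (no loop in the class)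
or meets the same bar F2 — none is separately attackable without `W`.

## Near-misses (documented, no `sorry` kept)
* `…WithoutTypeI`, `…WithoutDivFree`, `…WithoutPoloidal`: a witness would be a non-zero ancient Oseen-mild profile with
  a vortex loop whose periods grow backward faster than `((−t₀)/(−t))^{3/2}` — for bounded data this is again an
  (L)-type object (bounded ancient mild solutions with extra structure), for unbounded data the tree's `oseenDuhamel`
  is a divergent Bochner integral (junk), so no honest witness is available; not pursued.
* Dropping the CONCLUSION's non-stationarity clause does not trivialise the wall (the slice `v t₀` need not have a
  stagnation point of `curl`), so no cheap note there.

## HANDOFF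
landed: p671142 (LoadBearing: F3), p671423 (Reductions: F1/F2, `--negative-modulo HasClassLoop`), p671431 (Strata: F4),
p675060 (Amplitude: F6), p676158 (Rigidity: F7), p678688 (Recurrence: F7), p677901 (Island: F8).  Prepared, not yet
landed: `Negative/Floor.lean` (local instantaneous steadiness `∂ₜv(t₀,·) = 0` on an open set kills a witness; far-past
vorticity floor `sup_x (−t)‖curl v(t,·)‖ ≥ η(C)` of every witness; large velocity forces nearby vorticity) — waits for the
farm to build `…ClockCeiling{OpenSetSteadyLiouville,FarPastVorticityFloor,VelocityForcesVorticity}`.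
By name (director addendum): the equivalent wall form `NoLoopsWall.frequencyGrowthExponent_iff_noLoops` lives in
`Cruxes/PoloidalWindowRigidity/Lines/noloops_wall.lean` (sha 275b7c618305); this file's `criterion` is the same fact in
`HasClassLoop` form (Lines files are not imported here).
Next regimes if re-armed: (i) if a line is picked, attack its stubs' extra hypotheses by mutation (F3-style witnesses
without mildness are cheap: Gaussian columns, drifting banks); (ii) the only live ansätze are A1′ (RSS, α ≈ 1) and A2
(DSS) — progress there is literature (Pineau–Vicol programme), not kit; (iii) «island ⇔ loop» is DONE (F8); the remaining cheap lemma is `Negative/Floor.lean` (above) once the farm builds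
its imports; (iv) a scaling normalisation of `W` (loop at `t = −1`) needs a curl-of-`nsRescale` slice lemma — nicety.
-/

noncomputable section

-- the summit and its single sub-problem share the name (CONVENTIONS §1)
set_option linter.dupNamespace false

namespace Summit.NavierStokesRegularity.NavierStokesRegularity.Cruxes.FrequencyGrowthExponent.Disproof

open Set Function Filter Topology Metric
open scoped RealInnerProductSpace InnerProductSpace
open Literature.Analysis Literature.Analysis.FluidPDE
open Summit.NavierStokesRegularity.NavierStokesRegularity.Theses.LoopPeriodRatchet
open Summit.NavierStokesRegularity.NavierStokesRegularity.Theorems.LoopPeriodRatchetNoLoopsOfGrowth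
open Summit.NavierStokesRegularity.NavierStokesRegularity.Theorems.LoopPeriodRatchetNoLoopsOfRatchet
open Summit.NavierStokesRegularity.NavierStokesRegularity.Theorems.LoopPeriodRatchetPeriodScalingBound
open Summit.NavierStokesRegularity.NavierStokesRegularity.Theorems.PoloidalWindowDoorPoloidalWindowRigidityWindow
open Summit.NavierStokesRegularity.NavierStokesRegularity.Theorems.PoloidalWindowDoorPoloidalWindowRigidityHotLoopsPeakless
open Summit.NavierStokesRegularity.NavierStokesRegularity.Theorems.FrequencyGrowthExponent

/-! # §A  The refutation criterion and the (L)-bar (F1, F2) — LANDED `Negative/Reductions.lean` (p671423), re-exported -/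

/-- `W`: the class carries a non-stationary closed vortex line (`Negative.HasClassLoop`, the construction target). -/
abbrev W : Prop := Negative.HasClassLoop

/-- `W′`: the class carries a strict planar extremum of `±v₃` (`Negative.HasClassPlanarPeak`, the hot_loops form). -/
abbrev W' : Prop := Negative.HasClassPlanarPeak

/-- **F1 — the refutation criterion**: `¬ FrequencyGrowthExponent ↔ W` (the exponent, the constant and the ratio
clause are inert given the proved floor `PeriodScalingBound` + engine `NoLoopsOfGrowth`). -/
theorem criterion : ¬ FrequencyGrowthExponent ↔ W := Negative.not_frequencyGrowthExponent_iff

/-- **F1′ — W kills the wall** (the negative lemma modulo `W`, landed p671423). -/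
theorem false_of_W (hW : W) : ¬ FrequencyGrowthExponent := Negative.frequencyGrowthExponent_false_of_hasClassLoop hW

/-- **F1″ — a planar peak kills the wall** (via the landed `zero_of_strictPlanarExtremum`). -/
theorem false_of_W' (hW : W') : ¬ FrequencyGrowthExponent := Negative.frequencyGrowthExponent_false_of_hasClassPlanarPeak hW

/-- **F1‴ — the two open walls of the route coincide**: `FrequencyGrowthExponent ↔ PeriodRatchet`. -/
theorem walls_iff : FrequencyGrowthExponent ↔ PeriodRatchet := Negative.frequencyGrowthExponent_iff_periodRatchet

/-- **F2 — the adversary's bar**: a witness refutes the KNSS Liouville conjecture (L) (it is, after a time shift, a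
non-constant bounded ancient mild solution = a Type-I blow-up profile). -/
theorem bar (hW : W) : ¬ _root_.Summit.NavierStokesRegularity.NavierStokesRegularity.LiouvilleConjectureNS :=
  Negative.not_liouvilleConjectureNS_of_hasClassLoop hW

/-- **F2′** — equivalently (L) implies the wall. -/
theorem of_liouville (hL : _root_.Summit.NavierStokesRegularity.NavierStokesRegularity.LiouvilleConjectureNS) :
    FrequencyGrowthExponent := by
  by_contra h
  exact Negative.not_liouvilleConjectureNS_of_not_frequencyGrowthExponent h hL

/-! # §B  Load-bearing binders (F3) — LANDED `Negative/LoadBearing.lean` (p671142), re-exported -/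

/-- **Any proof must use the Oseen–Duhamel binder**: the wall with the mild identity dropped is false
(Gaussian-column witness, `Negative.frequencyGrowthExponent_false_without_mild`). -/
theorem mild_loadBearing : ¬ Negative.FrequencyGrowthExponentWithoutMild :=
  Negative.frequencyGrowthExponent_false_without_mild

/-- **The hypothesis loop's non-stationarity clause is not decoration**: dropped, the wall is false (zero profile,
`Negative.frequencyGrowthExponent_false_without_nonstationary`). -/
theorem nonstationary_loadBearing : ¬ Negative.FrequencyGrowthExponentWithoutNonstationary :=
  Negative.frequencyGrowthExponent_false_without_nonstationary

/-! # §C  Settled strata carry no loop (F4) — LANDED `Negative/Strata.lean` (p671431), specialised to `Negative.IsVortexLoop` -/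

section Strata

variable {C : ℝ} {v : ℝ → EuclideanSpace ℝ (Fin 3) → EuclideanSpace ℝ (Fin 3)}

/-- No loop if the slice vorticity vanishes identically. -/
theorem no_loop_of_curl_eq_zero (hcurl : ∀ t < 0, ∀ y, curl (v t) y = 0) {t : ℝ} (ht : t < 0)
    (c : ℝ → EuclideanSpace ℝ (Fin 3)) (T : ℝ) : ¬ Negative.IsVortexLoop v t c T :=
  fun h => Negative.no_nonstationary_vortexLine_of_curl_eq_zero hcurl ht c h.2.2.2

/-- **W is not translation-invariant** (in any direction `e ≠ 0`). -/
theorem no_loop_of_translate_invariant (hrate : HasTypeITimeDecay C v)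
    (hcont : ContinuousOn (uncurry v) (Iio (0 : ℝ) ×ˢ univ))
    (hmild : ∀ s t : ℝ, s < t → t < 0 → ∀ y : EuclideanSpace ℝ (Fin 3),
      v t y = UnboundedOperators.heatExtension (v s) (t - s) y - oseenDuhamel 1 s v v t y)
    (hdiv : ∀ t < 0, VectorCalculus.IsDivFree (v t)) {e : EuclideanSpace ℝ (Fin 3)} (he : e ≠ 0)
    (hinv : ∀ t < 0, ∀ (y : EuclideanSpace ℝ (Fin 3)) (l : ℝ), v t (y + l • e) = v t y)
    {t : ℝ} (ht : t < 0) (c : ℝ → EuclideanSpace ℝ (Fin 3)) (T : ℝ) : ¬ Negative.IsVortexLoop v t c T :=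
  no_loop_of_curl_eq_zero (Negative.curl_eq_zero_of_translate_invariant hrate hcont hmild hdiv he hinv) ht c T

/-- **W has no aligned vorticity window** (on any slice, any non-empty open set, any direction). -/
theorem no_loop_of_aligned_window (hrate : HasTypeITimeDecay C v)
    (hcont : ContinuousOn (uncurry v) (Iio (0 : ℝ) ×ˢ univ))
    (hmild : ∀ s t : ℝ, s < t → t < 0 → ∀ y : EuclideanSpace ℝ (Fin 3),
      v t y = UnboundedOperators.heatExtension (v s) (t - s) y - oseenDuhamel 1 s v v t y)
    (hdiv : ∀ t < 0, VectorCalculus.IsDivFree (v t)) {s : ℝ} (hs : s < 0) {e : EuclideanSpace ℝ (Fin 3)}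
    (he : e ≠ 0) {U : Set (EuclideanSpace ℝ (Fin 3))} (hU : IsOpen U) (hne : U.Nonempty)
    (hal : ∀ y ∈ U, cross (curl (v s) y) e = 0)
    {t : ℝ} (ht : t < 0) (c : ℝ → EuclideanSpace ℝ (Fin 3)) (T : ℝ) : ¬ Negative.IsVortexLoop v t c T :=
  no_loop_of_curl_eq_zero (Negative.curl_eq_zero_of_aligned_window hrate hcont hmild hdiv hs he hU hne hal) ht c T

/-- **W is not flat** (`∂₀ v₂ ≢ 0` on some slice). -/
theorem no_loop_of_flat (hrate : HasTypeITimeDecay C v)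
    (hcont : ContinuousOn (uncurry v) (Iio (0 : ℝ) ×ˢ univ))
    (hmild : ∀ s t : ℝ, s < t → t < 0 → ∀ y : EuclideanSpace ℝ (Fin 3),
      v t y = UnboundedOperators.heatExtension (v s) (t - s) y - oseenDuhamel 1 s v v t y)
    (hdiv : ∀ t < 0, VectorCalculus.IsDivFree (v t))
    (hpol : ∀ s < 0, ∀ y, ⟪curl (v s) y, EuclideanSpace.single 2 1⟫_ℝ = 0)
    (hflat : ∀ s < 0, ∀ y, fderiv ℝ (v s) y (EuclideanSpace.single 0 1) 2 = 0)
    {t : ℝ} (ht : t < 0) (c : ℝ → EuclideanSpace ℝ (Fin 3)) (T : ℝ) : ¬ Negative.IsVortexLoop v t c T :=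
  no_loop_of_curl_eq_zero (Negative.curl_eq_zero_of_flat hrate hcont hmild hdiv hpol hflat) ht c T

/-- **W is not axisymmetric about the e₃-axis** (KNSS rung: poloidal & axisymmetric ⇒ swirl-free ⇒ zero). -/
theorem no_loop_of_axisymmetric (hrate : HasTypeITimeDecay C v)
    (hcont : ContinuousOn (uncurry v) (Iio (0 : ℝ) ×ˢ univ))
    (hmild : ∀ s t : ℝ, s < t → t < 0 → ∀ y : EuclideanSpace ℝ (Fin 3),
      v t y = UnboundedOperators.heatExtension (v s) (t - s) y - oseenDuhamel 1 s v v t y)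
    (hdiv : ∀ t < 0, VectorCalculus.IsDivFree (v t))
    (hpol : ∀ s < 0, ∀ y, ⟪curl (v s) y, EuclideanSpace.single 2 1⟫_ℝ = 0)
    (haxi : ∀ s < 0, IsAxisymmetric (v s))
    {t : ℝ} (ht : t < 0) (c : ℝ → EuclideanSpace ℝ (Fin 3)) (T : ℝ) : ¬ Negative.IsVortexLoop v t c T :=
  no_loop_of_curl_eq_zero (Negative.curl_eq_zero_of_axisymmetric hrate hcont hmild hdiv hpol haxi) ht c T

end Strata

/-! # §I  Line structure under the wall (F9): given ⟨27893⟩, the residual cruxes 22493 / 22881 are the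
hypothesis-free Frobenius-class statement — their loop-free / no-planar-extremum hypotheses are then automatic -/

/-- `OpenLoopLiouville` (22493) with its loop-free hypothesis DROPPED, equivalently `PlanarExtremumLiouville` (22881)
with its no-strict-planar-extremum hypothesis dropped: every NONFLAT e₃-poloidal class profile in the Frobenius class
(`⟪Dv(s)[curl v(s)], e₃⟫ ≡ 0`) is not backward-singular at the apex. -/
def FrobeniusLiouville : Prop :=
  ∀ (C : ℝ) (v : ℝ → EuclideanSpace ℝ (Fin 3) → EuclideanSpace ℝ (Fin 3)), HasTypeITimeDecay C v →
    ContinuousOn (uncurry v) (Iio (0 : ℝ) ×ˢ univ) →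
    (∀ s t : ℝ, s < t → t < 0 → ∀ x, v t x = UnboundedOperators.heatExtension (v s) (t - s) x - oseenDuhamel 1 s v v t x) →
    (∀ t < 0, VectorCalculus.IsDivFree (v t)) →
    (∀ s < 0, ∀ y, ⟪curl (v s) y, EuclideanSpace.single 2 1⟫_ℝ = 0) →
    (∀ s < 0, ∀ y, ⟪fderiv ℝ (v s) y (curl (v s) y), EuclideanSpace.single 2 1⟫_ℝ = 0) →
    (∃ s < 0, ∃ y, fderiv ℝ (v s) y (EuclideanSpace.single 0 1) 2 ≠ 0) →
    ¬ IsBackwardSingularPoint v 0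

section LineStructure

variable {C : ℝ} {v : ℝ → EuclideanSpace ℝ (Fin 3) → EuclideanSpace ℝ (Fin 3)}

/-- Under the wall, every class e₃-poloidal profile is loop-free in the currency of 22493 / 22880 (`criterion`). -/
theorem loopFree_of_wall (hG : FrequencyGrowthExponent) (hrate : HasTypeITimeDecay C v)
    (hcont : ContinuousOn (uncurry v) (Iio (0 : ℝ) ×ˢ univ))
    (hmild : ∀ s t : ℝ, s < t → t < 0 → ∀ x,
      v t x = UnboundedOperators.heatExtension (v s) (t - s) x - oseenDuhamel 1 s v v t x)
    (hdiv : ∀ t < 0, VectorCalculus.IsDivFree (v t))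
    (hpol : ∀ s < 0, ∀ y, ⟪curl (v s) y, EuclideanSpace.single 2 1⟫_ℝ = 0) :
    ∀ s : ℝ, s < 0 → ∀ (γ : ℝ → EuclideanSpace ℝ (Fin 3)) (ℓ : ℝ), 0 < ℓ →
      (∀ θ, HasDerivAt γ (curl (v s) (γ θ)) θ) → (∀ θ, γ (θ + ℓ) = γ θ) → curl (v s) (γ 0) = 0 := by
  intro s hs γ ℓ hℓ hγ hper
  by_contra hne
  exact false_of_W ⟨C, v, hrate, hcont, hmild, hdiv, hpol, s, hs, γ, ℓ, hℓ, hper, hγ, 0, hne⟩ hG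

end LineStructure

/-- **F9a.** Given ⟨27893⟩, `OpenLoopLiouville` (22493) is equivalent to `FrobeniusLiouville`: the loop-free hypothesis
is implied by the wall and carries no further information. -/
theorem openLoopLiouville_iff_frobeniusLiouville_of_wall (hG : FrequencyGrowthExponent) :
    OpenLoopLiouville ↔ FrobeniusLiouville := by
  constructor
  · intro hO C v hrate hcont hmild hdiv hpol hfro hnf
    exact hO C v hrate hcont hmild hdiv hpol hfro hnf (loopFree_of_wall hG hrate hcont hmild hdiv hpol)
  · intro hF C v hrate hcont hmild hdiv hpol hfro hnf _
    exact hF C v hrate hcont hmild hdiv hpol hfro hnf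

/-- **F9b.** Given ⟨27893⟩, `PlanarExtremumLiouville` (22881) is equivalent to `FrobeniusLiouville`: its
no-strict-planar-extremum hypothesis follows from the wall through the proved `NoPlanarExtremum` (22880). -/
theorem planarExtremumLiouville_iff_frobeniusLiouville_of_wall (hG : FrequencyGrowthExponent) :
    PlanarExtremumLiouville ↔ FrobeniusLiouville := by
  constructor
  · intro hP C v hrate hcont hmild hdiv hpol hfro hnf
    exact hP C v hrate hcont hmild hdiv hpol hfro hnf
      (_root_.Summit.NavierStokesRegularity.NavierStokesRegularity.Theorems.LoopPeriodRatchetNoPlanarExtremum.noPlanarExtremum_proof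
        C v hrate hcont hmild hdiv hpol
        (loopFree_of_wall hG hrate hcont hmild hdiv hpol))
  · intro hF C v hrate hcont hmild hdiv hpol hfro hnf _
    exact hF C v hrate hcont hmild hdiv hpol hfro hnf

/-- **F9c.** Hence, given the wall, the two residual cruxes of the line coincide. -/
theorem openLoopLiouville_iff_planarExtremumLiouville_of_wall (hG : FrequencyGrowthExponent) :
    OpenLoopLiouville ↔ PlanarExtremumLiouville :=
  (openLoopLiouville_iff_frobeniusLiouville_of_wall hG).trans
    (planarExtremumLiouville_iff_frobeniusLiouville_of_wall hG).symm

/-! # §D  Targets — none served this cycle (see the module docstring) -/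

/-! # §E  Near-misses — documented in the module docstring; no `sorry` kept in this version -/

/-! # §F  Amplitude / energy thresholds (F6) — LANDED `Negative/Amplitude.lean` (p675060), re-exported in `W`-form -/

/-- **W may assume, and must deliver, unbounded subcritical norms** (`Negative.hasClassLoop_iff_large`). -/
theorem W_iff_large : W ↔
    ∃ (C : ℝ) (v : ℝ → EuclideanSpace ℝ (Fin 3) → EuclideanSpace ℝ (Fin 3)),
      HasTypeITimeDecay C v ∧ ContinuousOn (uncurry v) (Iio (0 : ℝ) ×ˢ univ) ∧
      (∀ s t : ℝ, s < t → t < 0 → ∀ x, v t x = UnboundedOperators.heatExtension (v s) (t - s) x - oseenDuhamel 1 s v v t x) ∧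
      (∀ t < 0, VectorCalculus.IsDivFree (v t)) ∧
      (∀ s < 0, ∀ y, ⟪curl (v s) y, EuclideanSpace.single 2 1⟫_ℝ = 0) ∧
      (∃ t : ℝ, t < 0 ∧ ∃ (c : ℝ → EuclideanSpace ℝ (Fin 3)) (T : ℝ), Negative.IsVortexLoop v t c T) ∧
      (∀ (p : ENNReal), 1 ≤ p → p < 3 → ∀ N : ℝ, ∃ t' < 0,
        ENNReal.ofReal N < MeasureTheory.eLpNorm (v t') p MeasureTheory.volume) :=
  Negative.hasClassLoop_iff_large

/-- **No small witness** (`Negative.exists_threshold_no_small_witness`, the loop clause). -/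
theorem W_threshold : ∃ ε : ℝ, 0 < ε ∧ ∀ (C : ℝ) (v : ℝ → EuclideanSpace ℝ (Fin 3) → EuclideanSpace ℝ (Fin 3)),
    HasTypeITimeDecay C v → ContinuousOn (uncurry v) (Iio (0 : ℝ) ×ˢ univ) →
    (∀ s t : ℝ, s < t → t < 0 → ∀ x, v t x = UnboundedOperators.heatExtension (v s) (t - s) x - oseenDuhamel 1 s v v t x) →
    (∀ t < 0, VectorCalculus.IsDivFree (v t)) →
    ∀ t < 0, ∀ (c : ℝ → EuclideanSpace ℝ (Fin 3)) (T : ℝ), Negative.IsVortexLoop v t c T →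
      ε < C ∧ ∀ R : ℝ, 0 < R → ∃ t' ≤ -R, ∃ x, ε / Real.sqrt (-t') < ‖v t' x‖ := by
  obtain ⟨ε, hε, h⟩ := Negative.exists_threshold_no_small_witness
  exact ⟨ε, hε, fun C v hrate hcont hmild hdiv => (h C v hrate hcont hmild hdiv).2.2⟩

/-! # §G  Rigidity strata (F7) — LANDED `Negative/Rigidity.lean` (p676158), specialised statements -/

section Rigidity

variable {C : ℝ} {v : ℝ → EuclideanSpace ℝ (Fin 3) → EuclideanSpace ℝ (Fin 3)}

/-- **Every witness has Type-I constant at least one** (unit viscosity, rate `C/√(−t)`). -/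
theorem W_constant_ge_one (hrate : HasTypeITimeDecay C v)
    (hcont : ContinuousOn (uncurry v) (Iio (0 : ℝ) ×ˢ univ))
    (hmild : ∀ s t : ℝ, s < t → t < 0 → ∀ x,
      v t x = UnboundedOperators.heatExtension (v s) (t - s) x - oseenDuhamel 1 s v v t x)
    (hdiv : ∀ t < 0, VectorCalculus.IsDivFree (v t)) {t : ℝ} (ht : t < 0) {c : ℝ → EuclideanSpace ℝ (Fin 3)} {T : ℝ}
    (hloop : Negative.IsVortexLoop v t c T) : 1 ≤ C :=
  Negative.one_le_typeI_constant_of_isVortexLoop hrate hcont hmild hdiv ht hloop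

/-- **W is not spatially periodic** (no period vector `L ≠ 0`). -/
theorem no_loop_of_periodic (hrate : HasTypeITimeDecay C v)
    (hcont : ContinuousOn (uncurry v) (Iio (0 : ℝ) ×ˢ univ))
    (hmild : ∀ s t : ℝ, s < t → t < 0 → ∀ x,
      v t x = UnboundedOperators.heatExtension (v s) (t - s) x - oseenDuhamel 1 s v v t x)
    (hdiv : ∀ t < 0, VectorCalculus.IsDivFree (v t)) {L : EuclideanSpace ℝ (Fin 3)} (hL : L ≠ 0)
    (hper : ∀ t < 0, ∀ x, v t (x + L) = v t x) {t : ℝ} (ht : t < 0) (c : ℝ → EuclideanSpace ℝ (Fin 3)) (T : ℝ) :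
    ¬ Negative.IsVortexLoop v t c T :=
  Negative.no_loop_of_periodic hrate hcont hmild hdiv hL hper ht c T

/-- **W is not backward self-similar.** -/
theorem no_loop_of_selfSimilar (hrate : HasTypeITimeDecay C v)
    (hcont : ContinuousOn (uncurry v) (Iio (0 : ℝ) ×ˢ univ))
    (hmild : ∀ s t : ℝ, s < t → t < 0 → ∀ x,
      v t x = UnboundedOperators.heatExtension (v s) (t - s) x - oseenDuhamel 1 s v v t x)
    (hdiv : ∀ t < 0, VectorCalculus.IsDivFree (v t))
    (hss : ∀ a : ℝ, 0 < a → ∀ t < (0 : ℝ), ∀ x : EuclideanSpace ℝ (Fin 3), a • v (a ^ 2 * t) (a • x) = v t x)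
    {t : ℝ} (ht : t < 0) (c : ℝ → EuclideanSpace ℝ (Fin 3)) (T : ℝ) : ¬ Negative.IsVortexLoop v t c T :=
  Negative.no_loop_of_selfSimilar hrate hcont hmild hdiv hss ht c T

/-- **W has no open irrotational set on any slice** (no compact-core ring with potential exterior). -/
theorem no_loop_of_openSet_curl_eq_zero (hrate : HasTypeITimeDecay C v)
    (hcont : ContinuousOn (uncurry v) (Iio (0 : ℝ) ×ˢ univ))
    (hmild : ∀ s t : ℝ, s < t → t < 0 → ∀ x,
      v t x = UnboundedOperators.heatExtension (v s) (t - s) x - oseenDuhamel 1 s v v t x)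
    (hdiv : ∀ t < 0, VectorCalculus.IsDivFree (v t)) {t₀ : ℝ} (ht₀ : t₀ < 0)
    {U : Set (EuclideanSpace ℝ (Fin 3))} (hU : IsOpen U) (hne : U.Nonempty) (hcurl : ∀ x ∈ U, curl (v t₀) x = 0)
    {t : ℝ} (ht : t < 0) (c : ℝ → EuclideanSpace ℝ (Fin 3)) (T : ℝ) : ¬ Negative.IsVortexLoop v t c T :=
  Negative.no_loop_of_openSet_curl_eq_zero hrate hcont hmild hdiv ht₀ hU hne hcurl ht c T

end Rigidity

/-! # §H  The island door is the loop door (F8) — LANDED `Negative/Island.lean` (p677901) -/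

/-- **W ⟺ a class e₃-poloidal profile with a planar island bracket** (`Negative.hasClassLoop_iff_hasIsland`). -/
theorem W_iff_island : W ↔
    ∃ (C : ℝ) (v : ℝ → EuclideanSpace ℝ (Fin 3) → EuclideanSpace ℝ (Fin 3)),
      HasTypeITimeDecay C v ∧ ContinuousOn (uncurry v) (Iio (0 : ℝ) ×ˢ univ) ∧
      (∀ s t : ℝ, s < t → t < 0 → ∀ x, v t x = UnboundedOperators.heatExtension (v s) (t - s) x - oseenDuhamel 1 s v v t x) ∧
      (∀ t < 0, VectorCalculus.IsDivFree (v t)) ∧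
      (∀ s < 0, ∀ y, ⟪curl (v s) y, EuclideanSpace.single 2 1⟫_ℝ = 0) ∧
      ∃ (s₀ z₁ σ M : ℝ) (K O : Set (EuclideanSpace ℝ (Fin 3))), s₀ < 0 ∧
        ((σ = 1 ∨ σ = -1) ∧ IsCompact K ∧ K.Nonempty ∧ (∀ y ∈ K, y 2 = z₁ ∧ σ * v s₀ y 2 = M) ∧
          IsOpen O ∧ K ⊆ O ∧ (∀ y ∈ O, y 2 = z₁ → σ * v s₀ y 2 ≤ M) ∧
          (∀ y ∈ O, y 2 = z₁ → σ * v s₀ y 2 = M → y ∈ K)) :=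
  Negative.hasClassLoop_iff_hasIsland

section Recurrence

variable {C : ℝ} {v : ℝ → EuclideanSpace ℝ (Fin 3) → EuclideanSpace ℝ (Fin 3)}

/-- **W is not steady** (nor time-periodic, nor locally time-recurrent: `Negative.no_loop_of_germ_timeRecurrent`). -/
theorem no_loop_of_steady (hrate : HasTypeITimeDecay C v)
    (hcont : ContinuousOn (uncurry v) (Iio (0 : ℝ) ×ˢ univ))
    (hmild : ∀ s t : ℝ, s < t → t < 0 → ∀ x,
      v t x = UnboundedOperators.heatExtension (v s) (t - s) x - oseenDuhamel 1 s v v t x)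
    (hdiv : ∀ t < 0, VectorCalculus.IsDivFree (v t)) (hsteady : ∀ s t : ℝ, s < 0 → t < 0 → v s = v t)
    {t : ℝ} (ht : t < 0) (c : ℝ → EuclideanSpace ℝ (Fin 3)) (T : ℝ) : ¬ Negative.IsVortexLoop v t c T :=
  Negative.no_loop_of_steady hrate hcont hmild hdiv hsteady ht c T

end Recurrence



end Summit.NavierStokesRegularity.NavierStokesRegularity.Cruxes.FrequencyGrowthExponent.Disproof

end
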